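import Summits.ResolutionOfSingularities.ResolutionOfSingularities.Theorems.EquisingularLiftEquisingularLiftNatHyperplaneLetterKill
import Summits.ResolutionOfSingularities.ResolutionOfSingularities.Theorems.EquisingularLiftEquisingularLiftNatLinearCentrePoints
import Summits.ResolutionOfSingularities.ResolutionOfSingularities.Theorems.EquisingularLiftEquisingularLiftProjectiveAmbientIntegralFibre
import Literature.AlgebraicGeometry.Motives.ReducedClosedSubschemeIso
import Literature.AlgebraicGeometry.Motives.ProjectiveSpaceLinearSubspaces
import Literature.AlgebraicGeometry.Resolution.ProjHomogeneousIdealSheaf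
import Literature.AlgebraicGeometry.Resolution.NonPrincipalLocus
import HarnessLib

/-!
# [OURS · L1 W4.5(b) · EL♮(3) · T23-A⁗ (F4)] HYPERPLANE LETTERS OVER `O`, part 2 — the linear form of a one-variable substitution,
# principal stalks of `V₊(ℓ̃)`, the support `V₊(ℓ) = {y | ℓ ∈ 𝔭_y}` on the special fibre, and the REDUCED trace `Λ · 𝒪_{ℙ_k} = 𝓘⟨V₊(ℓ)⟩`

res-type-027 g19 (FREE NAMED-RESERVE prover of chain w45b; res-L1-w45b-stub-4's `T23A4-ENGINE-WORD-v2.md` FINAL 81913c484db62a21 §3 (L1),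
my feasibility word `L/res-type-027/g19/F4-FEASIBILITY.md` 8a547123c3effec5, deliverable (H2), first half). Crux `EquisingularLiftNatThree` =
stmt-ResolutionOfSingularities-20148 (parent stmt-…-20038), route `EquisingularLift`, line `sections`. OURS; NOT a statement of any manuscript
([Hironaka2017] is a candidate under adjudication, nothing of it is asserted); AI-written, weaker than expert review. No `sorry`, no definition,
no instance; standard axioms. `--supports stmt-ResolutionOfSingularities-20148 --as helper`.

WHAT (currency: part 1 `…NatHyperplaneLetterKill` = the graded surjection `f` with ONE killed variable `a`, surviving variables listed by
`Fin.succAbove a`, value `f (X a) = C (−w) · Σ_j C (c (a.succAbove j)) · X j` for a coefficient vector `c` with `c a · w = 1`; the hyperplane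
`V₊(ℓ̃)`, `ℓ̃ = Σ_i C (c i) · X i`, is `Λ := ker (Proj f)`):
* `C_mul_generator_eq_sum`, `span_generator_eq_span_sum`, `ker_eq_span_sum` — **`ker f = (Σ_i C (c i) · X i) = (ℓ̃)`**; `isHomogeneous_linVal_one`,
  `isHomogeneous_sum_C_mul_X_one`;
* `isPrincipal_stalkIdeal_ker` — for ANY graded surjection with `ker f = (g)`, `g` a linear form: **the stalks of `ker (Proj f)` are principal**
  (chart `D₊(x_i)`: the ideal of sections is `(g / x_i)`, Literature `ker_projMap_ideal_basicOpen` + `awayIdeal_span_eq`; then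
  `IsLocallyPrincipalAt.isPrincipal_stalkIdeal`) = `LetterDatum` clause (l-ii);
* `support_ker_eq_setOf_mem` — over a field, `ker f_k = (ℓ)` ⇒ **`supp ker (Proj f_k) = {y | ℓ ∈ 𝔭_y}`** (⊇ through the generic point of `ℙ^r_k`,
  `Motives.coordSubspacePoint ∅`, whose image has homogeneous prime `ker f_k = (ℓ)`); `isClosed_setOf_mem`; `not_mem_support_of_not_mem`;
* ★ `comap_ker_eq_vanishingIdeal` — **`ker (Proj f_O) · 𝒪_{ℙ_k} = 𝓘⟨closure {y | ℓ ∈ 𝔭_y}⟩`** (part 1's base change `ker_projMap_subst_eq_comap` +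
  `Motives.ker_eq_vanishingIdeal_of_isReduced`, `ℙ^r_k` integral) = `LetterDatum` clause (l-i) for `jG = g = Proj φ`.
Part 3 (`…NatHyperplaneLetter`): the assembly `TCPlus.letterDatum_hyperplane`.

References: [Hartshorne1977, II Prop. 2.5, Prop. 5.9, Ex. 3.12 (a)]; R1 `…NatLinearCentre*` (res-D-pv-013; OURS, imported).
-/

set_option linter.dupNamespace false -- mandated namespace `Summit.<Summit>.<Problem>` of this single-conjunct summit

noncomputable section

open CategoryTheory CategoryTheory.Limits AlgebraicGeometry TopologicalSpace
open MvPolynomial HomogeneousLocalization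
open Literature.AlgebraicGeometry.Resolution
open AlgebraicGeometry.Scheme.IdealSheafData
open Summit.ResolutionOfSingularities.ResolutionOfSingularities.Cruxes.EquisingularLift.StrataSplit

attribute [local instance] MvPolynomial.gradedAlgebra

namespace Summit.ResolutionOfSingularities.ResolutionOfSingularities.Cruxes.EquisingularLiftNat

namespace LinearLetter

universe u

/-! ## One killed variable: the kernel is the linear form `ℓ̃ = Σ_i C (c i) · X i` -/

section Generator

variable {R : Type u} [CommRing R] {r : ℕ} (a : Fin (r + 1 + 1))
  (f : MvPolynomial (Fin (r + 1 + 1)) R →+* MvPolynomial (Fin (r + 1)) R)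
  (c : Fin (r + 1 + 1) → R) (w : R) (hw : c a * w = 1)
  (hva : f (X a) = C (-w) * ∑ j : Fin (r + 1), C (c (Fin.succAbove a j)) * X j)

/-- The variables other than `x_a` are exactly the `x_{a.succAbove j}`. [folklore] -/
theorem compl_range_succAbove : (Set.range (Fin.succAbove a))ᶜ = {a} := by
  rw [Fin.range_succAbove, compl_compl]

/-- The value `−w · Σ_j c_{a.succAbove j} · y_j` is a linear form. [folklore] -/
theorem isHomogeneous_linVal_one :
    (C (-w) * ∑ j : Fin (r + 1), C (c (Fin.succAbove a j)) * X j : MvPolynomial (Fin (r + 1)) R).IsHomogeneous 1 := by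
  have hS : (∑ j : Fin (r + 1), C (c (Fin.succAbove a j)) * X j : MvPolynomial (Fin (r + 1)) R).IsHomogeneous 1 := by
    refine IsHomogeneous.sum _ _ _ fun j _ => ?_
    simpa using (isHomogeneous_C _ (c (Fin.succAbove a j))).mul (isHomogeneous_X R j)
  simpa using (isHomogeneous_C _ (-w)).mul hS

/-- The linear form `ℓ̃ = Σ_i C (c i) · X i` is homogeneous of degree `1`. [folklore] -/
theorem isHomogeneous_sum_C_mul_X_one : (∑ i, C (c i) * X i : MvPolynomial (Fin (r + 1 + 1)) R).IsHomogeneous 1 :=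
  IsHomogeneous.sum _ _ _ fun i _ => by simpa using (isHomogeneous_C _ (c i)).mul (isHomogeneous_X R i)

include hw hva in
/-- **`c_a · (X a − rename (f (X a))) = Σ_i c_i · X i = ℓ̃`**: the kernel generator of part 1 is `w · ℓ̃`. [folklore] -/
theorem C_mul_generator_eq_sum :
    C (c a) * (X a - rename (Fin.succAbove a) (f (X a))) = ∑ i, C (c i) * X i := by
  have h1 : rename (Fin.succAbove a) (f (X a)) =
      C (-w) * ∑ j : Fin (r + 1), C (c (Fin.succAbove a j)) * X (Fin.succAbove a j) := by
    rw [hva, map_mul, rename_C, map_sum]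
    refine congrArg _ (Finset.sum_congr rfl fun j _ => ?_)
    rw [map_mul, rename_C, rename_X]
  rw [h1, Fin.sum_univ_succAbove _ a, mul_sub, ← mul_assoc, ← C_mul, mul_neg, hw, map_neg, C_1, neg_one_mul, sub_neg_eq_add]

include hw hva in
/-- Hence `(X a − rename (f (X a))) = (ℓ̃)` as ideals (`c_a` is a unit). [folklore] -/
theorem span_generator_eq_span_sum :
    Ideal.span {X a - rename (Fin.succAbove a) (f (X a))} = Ideal.span {∑ i, C (c i) * X i} := by
  rw [← C_mul_generator_eq_sum a f c w hw hva]
  exact (Ideal.span_singleton_mul_left_unit ((IsUnit.of_mul_eq_one w hw).map C) _).symm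

include hw hva in
/-- **`ker f = (ℓ̃)`**, `ℓ̃ = Σ_i C (c i) · X i` (part 1 `ker_subst_of_compl_eq_singleton` + `span_generator_eq_span_sum`). [folklore] -/
theorem ker_eq_span_sum (hfC : ∀ b : R, f (C b) = C b) (hfe : ∀ j : Fin (r + 1), f (X (Fin.succAbove a j)) = X j) :
    RingHom.ker f = Ideal.span {∑ i, C (c i) * X i} := by
  rw [ker_subst_of_compl_eq_singleton (Fin.succAbove a) f hfC hfe (compl_range_succAbove a),
    span_generator_eq_span_sum a f c w hw hva]

end Generator

/-! ## Principal stalks of `ker (Proj f)` when `ker f` is generated by one linear form -/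

section Principal

variable {R : Type} [CommRing R] {N r : ℕ} (e : Fin (r + 1) → Fin (N + 1))
  (f : (homogeneousSubmodule (Fin (N + 1)) R) →+*ᵍ (homogeneousSubmodule (Fin (r + 1)) R))
  (hf' : HomogeneousIdeal.irrelevant (homogeneousSubmodule (Fin (r + 1)) R) ≤
    (HomogeneousIdeal.irrelevant (homogeneousSubmodule (Fin (N + 1)) R)).map f)
  (hfC : ∀ b : R, f (C b) = C b) (hfe : ∀ j : Fin (r + 1), f (X (e j)) = X j)

include hfC hfe in
/-- **The stalks of `ker (Proj f)` are principal** when `ker f = (g)` for a linear form `g` (`LetterDatum` clause (l-ii)): over the chart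
`D₊(x_i)` the ideal of sections is generated by `g / x_i`. [cite: Hartshorne1977, II Prop. 5.9 and Ex. 3.12 (a)] -/
theorem isPrincipal_stalkIdeal_ker {g : MvPolynomial (Fin (N + 1)) R} (hg : g.IsHomogeneous 1)
    (hker : RingHom.ker f = Ideal.span {g}) (z : Proj (homogeneousSubmodule (Fin (N + 1)) R)) :
    (stalkIdeal (Proj.map f hf').ker z).IsPrincipal := by
  classical
  have hXR : ∀ i : Fin (N + 1), (X i : MvPolynomial (Fin (N + 1)) R) ∈ (homogeneousSubmodule (Fin (N + 1)) R) 1 :=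
    fun i => isHomogeneous_X R i
  -- a chart `D₊(x_i)` containing `z`
  have hcov := Proj.iSup_basicOpen_eq_top (homogeneousSubmodule (Fin (N + 1)) R)
    (fun i : Fin (N + 1) => (X i : MvPolynomial (Fin (N + 1)) R)) (irrelevant_le_span N R)
  have hz : z ∈ (⨆ i, Proj.basicOpen (homogeneousSubmodule (Fin (N + 1)) R) (X i)) := by
    rw [hcov]; trivial
  obtain ⟨i, hzi⟩ := Opens.mem_iSup.mp hz
  let U : (Proj (homogeneousSubmodule (Fin (N + 1)) R)).affineOpens :=
    ⟨Proj.basicOpen (homogeneousSubmodule (Fin (N + 1)) R) (X i),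
      Proj.isAffineOpen_basicOpen (homogeneousSubmodule (Fin (N + 1)) R) (X i) (hXR i) one_pos⟩
  have hgm : g ∈ (homogeneousSubmodule (Fin (N + 1)) R) 1 := hg
  refine IsLocallyPrincipalAt.isPrincipal_stalkIdeal
    ⟨U, hzi, (Proj.awayToSection (homogeneousSubmodule (Fin (N + 1)) R) (X i)).hom
      (mk₁ (homogeneousSubmodule (Fin (N + 1)) R) (hXR i) 1 g hgm), ?_⟩
  have hsurj : Function.Surjective f := subst_surjective e f.toRingHom (fun b => hfC b) (fun j => hfe j)
  have hspan : awayIdeal (homogeneousSubmodule (Fin (N + 1)) R) (hXR i) (Ideal.span {g}) =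
      Ideal.span {mk₁ (homogeneousSubmodule (Fin (N + 1)) R) (hXR i) 1 g hgm} := by
    have h := awayIdeal_span_eq (homogeneousSubmodule (Fin (N + 1)) R) (hXR i) (fun _ : Unit => g) (fun _ => 1)
      (fun _ => hgm)
    simp only [Set.range_const] at h
    exact h
  change (Proj.map f hf').ker.ideal U = _
  rw [ker_projMap_ideal_basicOpen f hf' hsurj one_pos (hXR i), hker, hspan, Ideal.map_span, Set.image_singleton]

end Principal

/-! ## The support on the special fibre: `supp ker (Proj f_k) = {y | ℓ ∈ 𝔭_y}` -/

section Support

variable {k : Type} [Field k] {N r : ℕ} (e : Fin (r + 1) → Fin (N + 1))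
  (fk : (homogeneousSubmodule (Fin (N + 1)) k) →+*ᵍ (homogeneousSubmodule (Fin (r + 1)) k))
  (hfk' : HomogeneousIdeal.irrelevant (homogeneousSubmodule (Fin (r + 1)) k) ≤
    (HomogeneousIdeal.irrelevant (homogeneousSubmodule (Fin (N + 1)) k)).map fk)
  (hfkC : ∀ b : k, fk (C b) = C b) (hfke : ∀ j : Fin (r + 1), fk (X (e j)) = X j)

include hfkC hfke in
/-- **The support of `ker (Proj f_k)` is the hyperplane `{y | ℓ ∈ 𝔭_y}`** when `ker f_k = (ℓ)`: `⊆` because `f_k ℓ = 0`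
(R1 `mem_asHomogeneousIdeal_of_mem_support`); `⊇` because the image of the generic point of `ℙ^r_k` has homogeneous prime `ker f_k = (ℓ) ≤ 𝔭_y`,
so `y` lies in its closure, inside the closed `range (Proj f_k) = supp`. [cite: Hartshorne1977, II Prop. 2.5 and Ex. 3.12 (a)] -/
theorem support_ker_eq_setOf_mem {ℓ : MvPolynomial (Fin (N + 1)) k} (hker : RingHom.ker fk = Ideal.span {ℓ}) :
    ((Proj.map fk hfk').ker.support : Set (Proj (homogeneousSubmodule (Fin (N + 1)) k))) =
      {y | ℓ ∈ y.asHomogeneousIdeal} := by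
  classical
  refine Set.Subset.antisymm (fun y hy => ?_) (fun y hy => ?_)
  · have hℓ : fk ℓ = 0 := by
      rw [← RingHom.mem_ker, hker]
      exact Ideal.mem_span_singleton_self ℓ
    exact EquisingularLiftNat.LinearCentre.mem_asHomogeneousIdeal_of_mem_support e fk hfk' hfkC hfke hy hℓ
  · haveI : IsClosedImmersion (Proj.map fk hfk') :=
      EquisingularLiftNat.LinearCentre.isClosedImmersion_projMap_kill e fk hfk' hfkC hfke
    -- the generic point `(0)` of `ℙ^r_k` and its image `η`
    let η₀ : Proj (homogeneousSubmodule (Fin (r + 1)) k) :=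
      Literature.AlgebraicGeometry.Motives.coordSubspacePoint (k := k) (N := r) ∅ Finset.univ_nonempty.ne_empty.symm
    set η : ProjectiveSpectrum (homogeneousSubmodule (Fin (N + 1)) k) := Proj.map fk hfk' η₀ with hη
    -- `𝔭_η = ker f_k = (ℓ) ≤ 𝔭_y`
    have hle : η.asHomogeneousIdeal ≤ (y : ProjectiveSpectrum (homogeneousSubmodule (Fin (N + 1)) k)).asHomogeneousIdeal := by
      refine toIdeal_le_toIdeal_iff.mp ?_
      intro G hG
      have hG' : fk G ∈ (ProjectiveSpectrum.asHomogeneousIdeal η₀).toIdeal := hG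
      rw [Literature.AlgebraicGeometry.Motives.toIdeal_coordSubspacePoint, Finset.coe_empty, Set.image_empty,
        Ideal.span_empty, Ideal.mem_bot] at hG'
      have hGk : G ∈ RingHom.ker fk := hG'
      rw [hker] at hGk
      have hℓy : ℓ ∈ (ProjectiveSpectrum.asHomogeneousIdeal y).toIdeal := hy
      exact (Ideal.span_singleton_le_iff_mem _).mpr hℓy hGk
    have hcl : (y : ProjectiveSpectrum (homogeneousSubmodule (Fin (N + 1)) k)) ∈
        closure ({η} : Set (ProjectiveSpectrum (homogeneousSubmodule (Fin (N + 1)) k))) :=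
      (ProjectiveSpectrum.le_iff_mem_closure _ η y).mp ((ProjectiveSpectrum.as_ideal_le_as_ideal _ η y).mp hle)
    have hηr : (η : Proj (homogeneousSubmodule (Fin (N + 1)) k)) ∈ Set.range (Proj.map fk hfk') := ⟨η₀, rfl⟩
    rw [EquisingularLiftNat.LinearCentre.support_ker_eq_range e fk hfk' hfkC hfke]
    exact closure_minimal (Set.singleton_subset_iff.mpr hηr) (Proj.map fk hfk').isClosedEmbedding.isClosed_range hcl

include hfk' hfkC hfke in
/-- The hyperplane `{y | ℓ ∈ 𝔭_y}` is closed (it is a support). [folklore] -/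
theorem isClosed_setOf_mem {ℓ : MvPolynomial (Fin (N + 1)) k} (hker : RingHom.ker fk = Ideal.span {ℓ}) :
    IsClosed {y : Proj (homogeneousSubmodule (Fin (N + 1)) k) | ℓ ∈ y.asHomogeneousIdeal} := by
  rw [← support_ker_eq_setOf_mem e fk hfk' hfkC hfke hker]
  exact (Proj.map fk hfk').ker.support.isClosed

include hfkC hfke in
/-- A point with `ℓ ∉ 𝔭_y` is off `supp ker (Proj f_k)` (the form consumed by the off-generic clause (l-iv)). [folklore] -/
theorem not_mem_support_of_not_mem {ℓ : MvPolynomial (Fin (N + 1)) k} (hker : RingHom.ker fk = Ideal.span {ℓ})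
    {y : Proj (homogeneousSubmodule (Fin (N + 1)) k)} (hy : ℓ ∉ y.asHomogeneousIdeal) :
    y ∉ ((Proj.map fk hfk').ker.support : Set (Proj (homogeneousSubmodule (Fin (N + 1)) k))) := by
  rw [support_ker_eq_setOf_mem e fk hfk' hfkC hfke hker]
  exact hy

end Support

/-! ## The reduced trace on the special fibre (`LetterDatum` clause (l-i)) -/

section Trace

variable {O k : Type} [CommRing O] [Field k] (π : O →+* k) (hπ : Function.Surjective π) {N r : ℕ}
  (e : Fin (r + 1) → Fin (N + 1))
  (φ : (homogeneousSubmodule (Fin (N + 1)) O) →+*ᵍ (homogeneousSubmodule (Fin (N + 1)) k))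
  (hφ : ∀ q, φ q = MvPolynomial.map π q)
  (hφ' : HomogeneousIdeal.irrelevant (homogeneousSubmodule (Fin (N + 1)) k) ≤
    (HomogeneousIdeal.irrelevant (homogeneousSubmodule (Fin (N + 1)) O)).map φ)
  (fO : (homogeneousSubmodule (Fin (N + 1)) O) →+*ᵍ (homogeneousSubmodule (Fin (r + 1)) O))
  (hfO' : HomogeneousIdeal.irrelevant (homogeneousSubmodule (Fin (r + 1)) O) ≤
    (HomogeneousIdeal.irrelevant (homogeneousSubmodule (Fin (N + 1)) O)).map fO)
  (hfOC : ∀ b : O, fO (C b) = C b) (hfOe : ∀ j : Fin (r + 1), fO (X (e j)) = X j)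
  (fk : (homogeneousSubmodule (Fin (N + 1)) k) →+*ᵍ (homogeneousSubmodule (Fin (r + 1)) k))
  (hfk' : HomogeneousIdeal.irrelevant (homogeneousSubmodule (Fin (r + 1)) k) ≤
    (HomogeneousIdeal.irrelevant (homogeneousSubmodule (Fin (N + 1)) k)).map fk)
  (hfkC : ∀ b : k, fk (C b) = C b) (hfke : ∀ j : Fin (r + 1), fk (X (e j)) = X j)

include hφ hfOC hfOe hfk' hfkC hfke hπ in
/-- ★ **The reduced trace**: `ker (Proj f_O) · 𝒪_{ℙ_k} = 𝓘⟨closure {y | ℓ ∈ 𝔭_y}⟩` for `g = Proj φ` the special fibre of `ℙ^N_O`, when the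
substitutions have `π`-compatible linear values and `ker f_k = (ℓ)` (`LetterDatum` clause (l-i) at the initial stage: part 1
`ker_projMap_subst_eq_comap`, then `ker (Proj f_k)` is the ideal sheaf of its range because `ℙ^r_k` is reduced, and that range is the
support `{y | ℓ ∈ 𝔭_y}`). [cite: Hartshorne1977, II Ex. 3.12 (a) and Example 3.2.6] -/
theorem comap_ker_eq_vanishingIdeal
    (hfO1 : ∀ i : Fin (N + 1), i ∉ Set.range e → (fO (X i) : MvPolynomial (Fin (r + 1)) O).IsHomogeneous 1)
    (hfkv : ∀ i : Fin (N + 1), i ∉ Set.range e → (fk (X i) : MvPolynomial (Fin (r + 1)) k) = MvPolynomial.map π (fO (X i)))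
    {ℓ : MvPolynomial (Fin (N + 1)) k} (hker : RingHom.ker fk = Ideal.span {ℓ}) :
    (Proj.map fO hfO').ker.comap (Proj.map φ hφ') =
      vanishingIdeal (⟨closure {y : Proj (homogeneousSubmodule (Fin (N + 1)) k) | ℓ ∈ y.asHomogeneousIdeal}, isClosed_closure⟩ :
        Closeds (Proj (homogeneousSubmodule (Fin (N + 1)) k))) := by
  haveI : IsClosedImmersion (Proj.map fk hfk') :=
    EquisingularLiftNat.LinearCentre.isClosedImmersion_projMap_kill e fk hfk' hfkC hfke
  haveI : IsIntegral (Proj (homogeneousSubmodule (Fin (r + 1)) k)) := isIntegral_proj_homogeneousSubmodule r k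
  rw [← ker_projMap_subst_eq_comap π hπ e φ hφ hφ' fO hfO' hfOC hfOe fk hfk' hfkC hfke hfO1 hfkv,
    Literature.AlgebraicGeometry.Motives.ker_eq_vanishingIdeal_of_isReduced (Proj.map fk hfk')]
  congr 1
  refine TopologicalSpace.Closeds.ext ?_
  change Set.range (Proj.map fk hfk').base = closure {y | ℓ ∈ y.asHomogeneousIdeal}
  rw [(isClosed_setOf_mem e fk hfk' hfkC hfke hker).closure_eq, ← support_ker_eq_setOf_mem e fk hfk' hfkC hfke hker,
    EquisingularLiftNat.LinearCentre.support_ker_eq_range e fk hfk' hfkC hfke]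

end Trace

end LinearLetter

end Summit.ResolutionOfSingularities.ResolutionOfSingularities.Cruxes.EquisingularLiftNat

end
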